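import Summits.ResolutionOfSingularities.ResolutionOfSingularities.Theorems.SubfieldContactPowAdjoin
import Summits.ResolutionOfSingularities.ResolutionOfSingularities.Theorems.SubfieldContactSpreads
import Summits.ResolutionOfSingularities.ResolutionOfSingularities.Theorems.MaxContactCutTauLadder
import HarnessLib

/-!
# MaxContactCutSubfieldContact — decomp-res node «SubfieldContact» (lens-6 g19, critic rows 147/147b/147c/147d),
tree file 6/6 of the node

Content VERBATIM from the decomp-res lens-6 g19 node file `HOME/decomp-res-lens-6/g19/SubfieldContact.lean` (rev 2
pin cc5614fe…, 933 l (append-only superset of rev 1 ba733ec4: +§11);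
= `parts/SubfieldContact-g19-rev2-cc5614fe.lean`; HOME = run/shared/lean/pub/decomp-res).  Critic: CRITIC-LEDGER
rows 147 (node 90f156f3 CLEARED) and 147b
(rev 1 = MAP +1, window (M2) consumed; «rev 1 ba733ec4 SUPERSEDES 90f156f3 as the source of
Theorems/SubfieldContactClasses», order 2026-08-30T22:19:25Z).
Landed by decomp-res writer g8 in the lens's namespace `…Theorems.SubfieldContactClasses`, split CONE-AWARE for
the 400-line limit: `SubfieldContactClasses`
(§1–§6), `SubfieldContactFrames` (§7), `SubfieldContactAbs` (§8–§9), `SubfieldContactPowAdjoin` (§10) are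
OUTSIDE the Theses cone (the lens's cone import
`MaxContactCutTauLadder` is used only by the «…_of_items» / «…_of_pieces» up-links from the MaxContactCut
items, which live in the in-cone wiring file
`MaxContactCutSubfieldContact`).  All `--supports stmt-ResolutionOfSingularities-29273` (`RungOne` = `E 2 → E 1`).
 Route bookkeeping (critic rows 147/147b):
ONE located-residual aside `E1NoSubDvd` (home `SubfieldContactClasses`) on 29273; the NEW LEMMA `SubfieldContactAbs`
(skeleton §9 BY NAME: stubs
`StalkSubfieldContactAbs` / `ContactSpreads` / `SubfieldContactGlue`, `PowAdjoinBase` PROVED by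
`powAdjoinBase_holds`) is booked as the prover target (kind aside
under the NAMED-RUNG RULE — outside the cone of `closes`); `SubfieldContact` is its kernel corollary
(`subfieldContact_of_abs`) and is NOT served separately.
rev 2 (cc5614fe, critic row 147c, order 2026-08-30T22:30:05Z: «supersedes rev 1 as source; land §10–§11») adds
§11 PIECE C PROVED (`subfieldContactGlue_holds`) to file 4/6;
PIECE L2 `ContactSpreads` PROVED (lens-6 g19 `parts/PieceL2-g19-52cf1017.lean`, critic row 147d, order 22:50:05Z
(2): «fold contactSpreads_holds + helpers into the pieces landing in the node
namespace, drop the scratch copies of the definitions») is file 5/6 `SubfieldContactSpreads`; so the support item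
`SubfieldContactAbs` is left with the SINGLE stub `StalkSubfieldContactAbs`
(composition: `subfieldContactAbs_of_pieces'' h contactSpreads_holds`).

IN-CONE WIRING: every theorem of the node that quotes a MaxContactCut item BY NAME (`e1Sub_of_items`,
`e_one_iff_noSubDvd_of_items`,
`e_one_iff_topNoAbs_of_items`, `e_one_iff_topNoAbs_of_pieces`, …) over the tree kernel `MaxContactCutTauLadder`
(`e_five_of_items`).  0 sorry.
Imports `SubfieldContactPowAdjoin` + `SubfieldContactSpreads` + the cone module `MaxContactCutTauLadder` (as the
lens).  INSIDE the Theses cone; never imported by the route file.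

[WRITER NOTE (decomp-res writer g8): section split only; namespace, opens, section variables and every declaration
exactly as in the lens (global
`set_option` dropped; the cone import replaced in the cone-free files by the cone-free `WeakOrderReduction`, already
under `PurityValveClasses`).]

(Sources: EGAIV4 §16.8; Matsumura1987 §26, Thm 30.6; Giraud1975; EncinasVillamayor2000GoodPoints §4;
BierstoneGrigorievMilmanWlodarczyk2011 §3; CossartJannsenSaito2020 Thm 1.4; CossartPiltant2008I Thm 2.1;
Cossart2011WeakMaximalContact; CossartPiltant2019; Kollar2007 §3.9.)
-/

noncomputable section

namespace Summit.ResolutionOfSingularities.ResolutionOfSingularities.Theorems.SubfieldContactClasses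

open CategoryTheory AlgebraicGeometry TopologicalSpace
open Literature.AlgebraicGeometry.Resolution
open Summit.ResolutionOfSingularities.ResolutionOfSingularities.Theorems
open WeakOrderReduction ForcedTowerClasses PurityValveClasses

/-! ## §1 The class predicate: contact over SOME finite-type field structure -/

/-! ## §2 The cut of `WOR n` and of `E 1` by subfield contact -/

/-! ## §3 The subfield-contact class is lens-5's class `E 5` read over the smaller field (CLOSED BY NAME) -/

/-- **`E1Sub` is CLOSED MODULO THE BOOKED INPUTS OF `E 5`**: the cell port X1 (`MaxContactCut.MarkedThreefoldResolution`,
28616), the fact CJS-B and lens-5's exhaustion bridge (tree `MaxContactCutTauLadder.e_five_of_items`). [folklore] -/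
theorem e1Sub_of_items (hM : Theses.MaxContactCut.MarkedThreefoldResolution)
    (hC : CossartJannsenSaito2020EmbeddedSequenceB.{0}) (hX : MaxContactCutExhaustion.ExhaustionBridge) : E1Sub :=
  e1Sub_of_e_five (MaxContactCutTauLadder.e_five_of_items hM hC hX)

/-! ## §4 THE NEW LEMMA: subfield contact is automatic prime to `p` -/

/-! ## §5 THE CONE EDGE: `E 1` is exactly its located residual, modulo the new lemma and `E 5` -/

/-- **EXACT modulo `SubfieldContact` and the three booked inputs of `E 5`** (X1 port 28616, CJS-B, lens-5's
`ExhaustionBridge`): `E 1 ⟺ E1NoSubDvd`. [folklore] -/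
theorem e_one_iff_noSubDvd_of_items (hS : SubfieldContact) (hM : Theses.MaxContactCut.MarkedThreefoldResolution)
    (hC : CossartJannsenSaito2020EmbeddedSequenceB.{0}) (hX : MaxContactCutExhaustion.ExhaustionBridge) :
    E 1 ↔ E1NoSubDvd :=
  e_one_iff_noSubDvd hS (MaxContactCutTauLadder.e_five_of_items hM hC hX)

/-! ## §6 The lens-6 column at marking `3`, `p ≠ 3`, is served without the hugging law -/

/-- `SeqDimFour 5 3` from lens-5's bridge at marking 3, the port X1 at `3! = 6` ONLY, and CJS-B. [folklore] -/
theorem seqDimFour_five_three_of_items (hX : MaxContactCutExhaustion.ExhaustionBridge)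
    (hM : MaxContactCutExhaustion.MarkedThreefoldResolutionAt (Nat.factorial 3))
    (hC : CossartJannsenSaito2020EmbeddedSequenceB.{0}) : SeqDimFour 5 3 :=
  (MaxContactCutTauLadder.seqDimFour_five_iff 3).2 (hX 3 (by norm_num) hM hC)

/-- … and from the booked inputs (X1 at 6 only): `WORPure 3 ⟸ SubfieldContact ∧ ExhaustionBridge ∧ X1(6) ∧ CJS-B ∧
(p = 3 column)`. [folklore] -/
theorem worPure_three_of_items_and_on3 (hS : SubfieldContact) (hX : MaxContactCutExhaustion.ExhaustionBridge)
    (hM : MaxContactCutExhaustion.MarkedThreefoldResolutionAt (Nat.factorial 3))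
    (hC : CossartJannsenSaito2020EmbeddedSequenceB.{0}) (h3 : WORPureOn (· = 3) 3) : WORPure 3 :=
  worPure_three_of_five_and_on3 hS (seqDimFour_five_three_of_items hX hM hC) h3

/-! ## §7 Typed attack plan for `SubfieldContact` (the prover's skeleton): structure maps over subfields,
RESTRICTION OF THE STRUCTURE FIELD PRESERVES CONTACT (PROVED), and the four remaining pieces with the
kernel-checked composition `subfieldContact_of_pieces` -/

/-! ### Restriction of the structure field preserves contact (PROVED) -/

/-! ### The four remaining pieces (statements) and the composition -/

/-! ## §8 (rev 1 · after CRITIC-LEDGER row 147, window g20 item (M2)) THE WILD RESIDUAL RE-TYPED EXACTLY BY ABSOLUTE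
STALK CONTACT.  Second typing of the located residual: `WORTopNoAbs n` = weak order reduction for the data having a CLOSED
top point WITHOUT absolute stalk contact (generation 17's field-free `IsAbsContactAt`).  KERNEL: (i) hypothesis-free,
`WORNoSubDvd n → WORTopNoAbs n` (a closed top point without absolute stalk contact forces `p ∣ n` by generation 18's
`isAbsContactAt_of_not_dvd` and forbids subfield contact over ANY field structure, relative operators being absolute ones:
tree `isAbsContactAt_of_isContactPt`); (ii) EXACT modulo the spreading lemma `SubfieldContactAbs` (= steps (2)–(5) of §3,
which never use `p ∤ n`, fed at the closed top points by absolute stalk contact): `WORNoSubDvd n ⟺ WORTopNoAbs n`,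
`E1NoSubDvd ⟺ E1TopNoAbs`, `E 1 ⟺ E1TopNoAbs` modulo `SubfieldContactAbs ∧ E 5`; (iii) `SubfieldContactAbs ⟹
SubfieldContact` in kernel; (iv) every datum with a closed top point in lens-4's `p`-POWER FORM lies in the re-typed
residual (tree `not_isAbsContactAt_of_pPowerFormAt`); the converse inclusion is the every-field dictionary of the g19
COMPANION «ContactFreeIsPPower» (`isAbsContactAt_iff_not_pPowerFormAt_closed`, separate tree file). -/

/-- … modulo `SubfieldContactAbs` and the three booked inputs of `E 5`. [folklore] -/
theorem e_one_iff_topNoAbs_of_items (hS : SubfieldContactAbs) (hM : Theses.MaxContactCut.MarkedThreefoldResolution)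
    (hC : CossartJannsenSaito2020EmbeddedSequenceB.{0}) (hX : MaxContactCutExhaustion.ExhaustionBridge) :
    E 1 ↔ E1TopNoAbs :=
  e_one_iff_topNoAbs hS (MaxContactCutTauLadder.e_five_of_items hM hC hX)

/-! ### §8b The re-typed residual contains every datum with a closed top point in `p`-POWER FORM (lens-4's object) -/

/-! ## §9 (rev 1) Typed attack plan for the spreading lemma `SubfieldContactAbs`: the core at ALL markings and the
kernel-checked composition (pieces F, L2, C of §7 are reused VERBATIM — they never use `p ∤ n`) -/

/-- **THE HOST MODULO THE FOUR PIECES AT ALL MARKINGS AND `E 5`'s INPUTS**: `E 1 ⟺ E1TopNoAbs`. [folklore] -/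
theorem e_one_iff_topNoAbs_of_pieces (hL1 : StalkSubfieldContactAbs) (hF : PowAdjoinBase) (hL2 : ContactSpreads)
    (hC : SubfieldContactGlue) (hM : Theses.MaxContactCut.MarkedThreefoldResolution)
    (hCJS : CossartJannsenSaito2020EmbeddedSequenceB.{0}) (hX : MaxContactCutExhaustion.ExhaustionBridge) :
    E 1 ↔ E1TopNoAbs :=
  e_one_iff_topNoAbs_of_items (subfieldContactAbs_of_pieces hL1 hF hL2 hC) hM hCJS hX

/-! ## §10 (rev 1) PIECE F PROVED: `k` has finite degree over `k^{(p^n)}(B ∖ S)` for an absolute `p`-basis `B` and a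
finite `S`, so the structure map over that subfield is again separated, locally of finite type and quasi-compact -/

/-! ## §11 (rev 2) PIECE C PROVED — `SubfieldContactGlue` (pure topology + the two proved node lemmas).
`Top = {ord ≥ n}` is compact (the scheme is Noetherian: locally of finite type and quasi-compact over a field —
Mathlib `LocallyOfFiniteType.isLocallyNoetherian`, `QuasiCompact.compactSpace_of_compactSpace`, and every subset of a
Noetherian space is compact); every top point `z` specialises to a CLOSED point `y` (Mathlib
`LocallyOfFiniteType.jacobsonSpace`, `nonempty_inter_closedPoints`), which is again a top point (the order does not
drop under specialisation on a regular scheme: tree `idealOrder_le_of_specializes`) and whose open neighbourhood `U_y`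
contains `z`; a finite subcover, `S := ⋃ Sᵢ`, `powAdjoin_mono` + `isContactPt_strOver_mono` (PIECE R) move every local
contact down to `F := k^{(p^n)}(B ∖ S)`, and PIECE F (`powAdjoinBase_holds`) gives the three morphism properties. -/

/-- `E 1 ⟺ E1NoSubDvd` from the two remaining pieces and the MaxContactCut items. [folklore] -/
theorem e_one_iff_noSubDvd_of_pieces'' (hL1 : StalkSubfieldContact) (hL2 : ContactSpreads)
    (hM : Theses.MaxContactCut.MarkedThreefoldResolution) (hCJS : CossartJannsenSaito2020EmbeddedSequenceB.{0})
    (hX : MaxContactCutExhaustion.ExhaustionBridge) : E 1 ↔ E1NoSubDvd :=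
  e_one_iff_noSubDvd_of_items (subfieldContact_of_pieces'' hL1 hL2) hM hCJS hX

/-- `E 1 ⟺ E1TopNoAbs` from the two remaining pieces (all-markings core) and the MaxContactCut items. [folklore] -/
theorem e_one_iff_topNoAbs_of_pieces'' (hL1 : StalkSubfieldContactAbs) (hL2 : ContactSpreads)
    (hM : Theses.MaxContactCut.MarkedThreefoldResolution) (hCJS : CossartJannsenSaito2020EmbeddedSequenceB.{0})
    (hX : MaxContactCutExhaustion.ExhaustionBridge) : E 1 ↔ E1TopNoAbs :=
  e_one_iff_topNoAbs_of_items (subfieldContactAbs_of_pieces'' hL1 hL2) hM hCJS hX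

end Summit.ResolutionOfSingularities.ResolutionOfSingularities.Theorems.SubfieldContactClasses
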